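import Literature.AlgebraicGeometry.ModuliOfAbelianVarieties.SiegelUniversalFamilyUniformisation
import Literature.AlgebraicGeometry.ModuliOfAbelianVarieties.SiegelAdmissiblePackageAlongPullbacks
import Literature.AlgebraicGeometry.ModuliOfAbelianVarieties.SiegelAdelicMarkingRebaseToUnitBasis
import HarnessLib

/-!
# ADM-NF «NORMAL-FORM ADMISSIBLE PACKAGE OF THE PULLED-BACK UNIVERSAL FAMILY»: at every complex point of `T` over a uniformised
# point `unif_c Z` of a piece, the pull-back `P_T = 𝓜.univ ×_𝓜 T` carries an admissible marking by `[J(Z), r]` with UNIT FRAME and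
# TAUTOLOGICAL complex coordinates `Ψ = Π_Z` ([Milne2005ShimuraVarieties] Thm. 6.11; [LangeBirkenhake1992] §8.1 Prop. 8.1.1;
# [MumfordFogartyKirwan1994] Ch. 7 §2 Def. 7.2)

Topic `Literature/AlgebraicGeometry/ModuliOfAbelianVarieties`; namespace `Literature.AlgebraicGeometry.ModuliOfAbelianVarieties`.
THEOREMS ONLY (no definition, no named fact, no instance, no notation, no `sorry`).  Cell `hodgecm-mathlib` (D-0151), FLOOR 0, P6 «MOD»
(crux hLiu418 = stmt-HodgeConjecture-24832, `--supports`), half A line L7 (socket `stub_UNIVFAM` of the E-line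
`Cruxes/HLiu418/Lines/F0_P6a_PELWitnessE.lean` ED. 4 :655 = ★ P-3 `siegelUniversalFamilyUniformisation` → in-house), organ **ADM-NF** (LA7-p01 (g0),
census 02:01:28Z on `F0/P6/STATUS.md`, LDEAL v1 §L7 «consumer-assembly road (iii)»).  HC_CM is proved only modulo the printed citations (2 remaining named inputs
hLiu418 24832, h413 24833) until rung 0 closes; this file is generic and changes no count.

WHAT IT MEASURES.  ★ P-3's conclusion has four conjuncts: the tautological period family, (C) the relative exponential chart, (G) additive
fibre analytifications, (ADM) admissible markings of the fibres of `P_T` by `[J(s̃ t), r]` with `γ = 1`, `Ψ = Π_{s̃ t}` and torus map `=` chart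
fibre map.  This file proves, from the (U3∃) junction clause of the piece ALONE (no analysis), everything in (ADM) ∧ (G) except the single
clause «torus map = chart fibre map»: at every complex point `x` of `T` with `ψ(x) = unif_c Z` and every integral representative `r ∈ K_δ(1)`,
the pulled-back triple `P_T` carries at `x` an (ADM)-package `(m, Θ, Λ)` for `(Z, r)` — ample `Θ` with `λ̄ = Λ(𝒪(Θ))`, a symplectic lift `Λ`
of the level structure whose tower read through `r` is `m.r` — whose marking is in NORMAL FORM: `m.γ = 1` and `m.Ψ = Π_Z`
(★ `siegelPeriodMap δ Z`); `m.toFun : ComplexTorus Π_Z → A_x(ℂ)` is then an additive analytification of the fibre (the (G) data).  So the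
load-bearing content of P-3 beyond (U3∃) is exactly (C) + «the canonical fibre maps `m_t.toFun` assemble to a holomorphic étale `ex`».

THE MATHEMATICS.  (§1) A marking `m` of `A` by `[J(Z), r]` with `r ∈ K_δ(1)` is re-based to `γ = 1` (★ `SiegelAdelicMarking.exists_rebase_γ_eq_one`:
`Λ_r = ℤ^{2g}`); then `Ψ` and `Π_Z` are both `ℂ`-linear for `J(Z)` on `ℝ^{2g}` (`Ψ_J` at `γ = 1`; ★ `jMatrix_siegelPeriodEquiv`), so
`C := Ψ ∘ Π_Z⁻¹` is `ℂ`-linear and the identity of `(ℝ∕ℤ)^{2g}` is a biholomorphic isomorphism `ComplexTorus Π_Z ≅ ComplexTorus Ψ`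
(★ `ComplexTorus.exists_homeomorph_of_baseChange` at `P = Q = 1`); composing `toFun` with it (★ `IsAnalytification.comp_of_isHomeomorph`) gives a
marking with `γ = 1`, `Ψ = Π_Z` and the SAME torsion parametrisation `m.r`.  (§2) By (U3∃) the universal triple pulled back to the POINT
`unif_c Z` is admissible for `(Z, r)`; `P_T` at `x` is a second pull-back of `𝓜.univ` over the same moduli point (★
`PolarizedAbelianSchemeWithLevel.baseChange_isBaseChangeVia`, the point equation `x ≫ ψ ≫ ι_c ≫ pr = s_Z` by ★ `AlgPoints.baseChangeEquiv_symm_apply_left`),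
so the (ADM)-package moves to `P_T` at `x` (★ RD-T3 `SiegelAdelicMarking.exists_admPackage_along_isBaseChangeVia₂`), and §1 normalises its marking
(the tower clause only sees `m.r`).

* §1 `SiegelAdelicMarking.exists_normalForm_of_γ_eq_one`, **`SiegelAdelicMarking.exists_normalForm_of_mem_one`** — normal form `γ = 1`, `Ψ = Π_Z`, same `r`.
* §2 **`exists_admPackage_normalForm_of_junction`** — THE HEAD (binders = ★ P-3's, token for token where they overlap).

## References
* [Milne2005ShimuraVarieties] J. S. Milne, *Introduction to Shimura Varieties* (2005; rev. 2017), §6 Thm. 6.11 pp. 74–75, (63) p. 116.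
* [LangeBirkenhake1992] H. Lange, Ch. Birkenhake, *Complex Abelian Varieties* (1992), §1.1.2; §8.1 Prop. 8.1.1 (`X_Z = ℂ^g∕(Z, D)ℤ^{2g}`).
* [MumfordFogartyKirwan1994] D. Mumford, J. Fogarty, F. Kirwan, *Geometric Invariant Theory*, 3rd ed. (1994), Ch. 7 §2 Def. 7.2 (p. 129), App. 7A pp. 234–235.
* [Lange2023AbelianVarietiesComplex] H. Lange, *Abelian Varieties over the Complex Numbers* (2023), §7.1.2 Lemma 7.1.6 (2), (7.3).
-/

set_option autoImplicit false

noncomputable section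

open CategoryTheory CategoryTheory.Limits AlgebraicGeometry Matrix Topology
open scoped Manifold ContDiff Matrix.Norms.Elementwise
open Literature.AlgebraicGeometry.Motives (SchemeOver ComplexPoints AlgPoints specOver AbelianVariety CartierDivisor)
open Literature.AlgebraicGeometry.AbelianSchemes (PolarizedAbelianSchemeWithLevel AbelianSchemeOver)
open Literature.Geometry.Kaehler (ComplexTorus)
open Literature.Geometry.Kaehler.ComplexTorus (proj mapMatrix)
open Literature.NumberTheory.Transcendental (IsAnalytification)
open Literature.NumberTheory.Automorphic (siegelUpperHalfSpace)
open Literature.NumberTheory.Adeles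

namespace Literature.AlgebraicGeometry.ModuliOfAbelianVarieties

open SiegelModuli (jOfSiegel)

variable {g : ℕ} {δ : Fin g → ℕ}

/-! ### §1 Normal form of a marking by `[J(Z), r]`, `r ∈ K_δ(1)`: unit frame and tautological complex coordinates -/

/-- **Tautological coordinates at unit frame.**  A marking of `A` by `[J(Z), r]` with `γ = 1` is replaced by one with `γ = 1`, `Ψ = Π_Z`
(★ `siegelPeriodEquiv`) and the same torsion parametrisation: `Ψ` and `Π_Z` are both `ℂ`-linear for `J(Z)` (`Ψ_J`; ★ `jMatrix_siegelPeriodEquiv`),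
so the identity of `(ℝ∕ℤ)^{2g}` is a biholomorphic isomorphism `ComplexTorus Π_Z → ComplexTorus Ψ` with analytic representation `Ψ ∘ Π_Z⁻¹`
(★ `ComplexTorus.exists_homeomorph_of_baseChange` at `P = Q = 1`), along which `toFun` is transported (★ `IsAnalytification.comp_of_isHomeomorph`).
[cite: LangeBirkenhake1992, §1.1.2 and §8.1 Prop. 8.1.1] [cite: Lange2023AbelianVarietiesComplex, §7.1.2 Lemma 7.1.6 (2), (7.3)] -/
theorem SiegelAdelicMarking.exists_normalForm_of_γ_eq_one (hδ : ∀ i, 0 < δ i) {Z : Matrix (Fin g) (Fin g) ℂ}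
    (hZ : Z ∈ siegelUpperHalfSpace g) {r : gspFinAdelic δ} {A : AbelianVariety ℂ}
    (m : SiegelAdelicMarking ⟨jOfSiegel δ Z, SiegelComplexRecordSystem.jOfSiegel_mem_C0pm hδ hZ⟩ r A) (hγ : m.γ = 1) :
    ∃ m' : SiegelAdelicMarking ⟨jOfSiegel δ Z, SiegelComplexRecordSystem.jOfSiegel_mem_C0pm hδ hZ⟩ r A,
      m'.γ = 1 ∧ m'.Ψ = siegelPeriodEquiv hδ hZ ∧ (∀ t, m'.toFun t = m.toFun t) ∧ ∀ v, m'.r v = m.r v := by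
  classical
  set Φ : (Fin g ⊕ Fin g → ℝ) ≃L[ℝ] (Fin g → ℂ) := siegelPeriodEquiv hδ hZ with hΦ
  -- `Π_Z` is `ℂ`-linear for `J(Z)`
  have hΦJ : ∀ x : Fin g ⊕ Fin g → ℝ, Φ (jOfSiegel δ Z *ᵥ x) = Complex.I • Φ x := by
    intro x
    rw [← SiegelModuli.jMatrix_siegelPeriodEquiv hδ hZ, ComplexTorus.jMatrix_mulVec, ComplexTorus.apply_latticeJ]
  -- `Ψ` is `ℂ`-linear for `J(Z)` (unit frame)
  have h1 : ∀ γ : GL (Fin g ⊕ Fin g) ℚ, γ = 1 →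
      (((γ⁻¹ : GL (Fin g ⊕ Fin g) ℚ) : Matrix (Fin g ⊕ Fin g) (Fin g ⊕ Fin g) ℚ).map (algebraMap ℚ ℝ)) = 1 := by
    rintro γ rfl
    rw [inv_one, Units.val_one]; exact Matrix.map_one _ (map_zero _) (map_one _)
  have hΨJ : ∀ x : Fin g ⊕ Fin g → ℝ, m.Ψ (jOfSiegel δ Z *ᵥ x) = Complex.I • m.Ψ x := by
    intro x
    have h := m.Ψ_J x
    rw [h1 m.γ hγ, Matrix.one_mulVec, Matrix.one_mulVec] at h
    exact h
  -- the analytic representation `C = Ψ ∘ Π_Z⁻¹` of the identity of `(ℝ∕ℤ)^{2g}` is `ℂ`-linear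
  set C : (Fin g → ℂ) ≃L[ℝ] (Fin g → ℂ) := Φ.symm.trans m.Ψ with hC
  have hCΦ : ∀ x, C (Φ x) = m.Ψ x := fun x => by
    rw [hC, ContinuousLinearEquiv.trans_apply, ContinuousLinearEquiv.symm_apply_apply]
  have hCI : ∀ u, C (Complex.I • u) = Complex.I • C u := by
    intro u
    obtain ⟨x, rfl⟩ := Φ.surjective u
    rw [← hΦJ, hCΦ, hCΦ, hΨJ]
  obtain ⟨e, he, -, headd, hehol, -⟩ := ComplexTorus.exists_homeomorph_of_baseChange Φ m.Ψ
    (1 : Matrix (Fin g ⊕ Fin g) (Fin g ⊕ Fin g) ℤ) 1 (one_mul 1) (one_mul 1) C hCI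
    (fun x => by rw [Matrix.map_one _ Int.cast_zero Int.cast_one, Matrix.one_mulVec, hCΦ])
  -- `e` is the identity map of `(ℝ∕ℤ)^{2g}`
  have he1 : ∀ t, e t = t := fun t => by
    rw [he]; funext i
    simp only [ComplexTorus.mapMatrix, Matrix.one_apply, ite_smul, one_smul, zero_smul, Finset.sum_ite_eq,
      Finset.mem_univ, if_true]
  refine ⟨{ γ := 1
            γ_isLatticeBasis := hγ ▸ m.γ_isLatticeBasis
            Ψ := Φ
            Ψ_J := fun x => ?_
            toFun := m.toFun ∘ e
            isAnalytification :=
              m.isAnalytification.comp_of_isHomeomorph e.isHomeomorph (hehol.mdifferentiable (by simp)) rfl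
            toFun_add := fun x y => by
              show m.toFun (e (x + y)) = m.toFun (e x) * m.toFun (e y)
              rw [headd, m.toFun_add] }, rfl, rfl, fun t => ?_, fun v => ?_⟩
  · -- the complex-structure clause at unit frame
    rw [h1 1 rfl, Matrix.one_mulVec, Matrix.one_mulVec]
    exact hΦJ x
  · -- same torus map
    show m.toFun (e t) = m.toFun t
    rw [he1]
  · -- same torsion parametrisation
    rw [SiegelAdelicMarking.r_def, SiegelAdelicMarking.r_def]
    show m.toFun (e (proj Φ fun i =>
      (((((1 : GL (Fin g ⊕ Fin g) ℚ)⁻¹ : GL (Fin g ⊕ Fin g) ℚ) : Matrix (Fin g ⊕ Fin g) (Fin g ⊕ Fin g) ℚ) *ᵥ v) i : ℝ))) =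
      m.toFun (proj m.Ψ fun i =>
        ((((m.γ⁻¹ : GL (Fin g ⊕ Fin g) ℚ) : Matrix (Fin g ⊕ Fin g) (Fin g ⊕ Fin g) ℚ) *ᵥ v) i : ℝ))
    rw [he1, hγ]
    rfl

/-- **Normal form of a marking by `[J(Z), r]` for integral `r ∈ K_δ(1)`**: unit frame `γ = 1` (★ `exists_rebase_γ_eq_one`: `Λ_r = ℤ^{2g}`) AND
tautological complex coordinates `Ψ = Π_Z` (`exists_normalForm_of_γ_eq_one`), with the SAME torsion parametrisation `r v` — so every clause
read through `m.r` (level towers, `AdelicCongr` matchings) survives the normalisation.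
[cite: Milne2005ShimuraVarieties, §6 Thm. 6.11 pp. 74–75 and (63) p. 116] [cite: LangeBirkenhake1992, §8.1 Prop. 8.1.1] -/
theorem SiegelAdelicMarking.exists_normalForm_of_mem_one (hδ : ∀ i, 0 < δ i) {Z : Matrix (Fin g) (Fin g) ℂ}
    (hZ : Z ∈ siegelUpperHalfSpace g) {r : gspFinAdelic δ} (hr : r ∈ principalLevelSubgroup δ 1) {A : AbelianVariety ℂ}
    (m : SiegelAdelicMarking ⟨jOfSiegel δ Z, SiegelComplexRecordSystem.jOfSiegel_mem_C0pm hδ hZ⟩ r A) :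
    ∃ m' : SiegelAdelicMarking ⟨jOfSiegel δ Z, SiegelComplexRecordSystem.jOfSiegel_mem_C0pm hδ hZ⟩ r A,
      m'.γ = 1 ∧ m'.Ψ = siegelPeriodEquiv hδ hZ ∧ ∀ v, m'.r v = m.r v := by
  obtain ⟨m₁, hγ₁, -, hr₁⟩ := m.exists_rebase_γ_eq_one hr
  obtain ⟨m', hγ', hΨ', -, hr'⟩ := m₁.exists_normalForm_of_γ_eq_one hδ hZ hγ₁
  exact ⟨m', hγ', hΨ', fun v => (hr' v).trans (hr₁ v)⟩

/-! ### §2 THE HEAD: the normal-form (ADM)-package of the pulled-back universal family at a complex point -/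

/-- **ADM-NF — THE NORMAL-FORM ADMISSIBLE PACKAGE OF THE PULLED-BACK UNIVERSAL FAMILY.**  In the setting of ★ P-3 `siegelUniversalFamilyUniformisation`
(`𝓜 : SiegelFineModuliScheme g N δ`, a piece `ι_c : S_c → 𝓜 ⊗ ℂ`, `ψ : T → S_c`, `P_T := 𝓜.univ.baseChange (ψ ≫ ι_c ≫ pr)`), let `x` be a complex
point of `T` and `q = ψ(x)` a point of the piece at which the (U3∃) FIBRE IDENTIFICATION holds for `(Z, r)` (the universal triple pulled back to
the `ℚ`-side reading `s_q` of `ι_c q` is admissible for `(Z, r)` — ★ `IsAdmissibleAt`; in P-3, `q = unif_c (s̃ t)` and this is the (U3) binder),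
with `r ∈ K_δ(1)` (every principal representative `diag(1, u·1)` is).  Then `P_T` carries AT `x` an (ADM)-package for `(Z, r)`: a marking `m` of
the fibre `(P_T.A)_x` by `[J(Z), r]`, an ample `Θ` with `λ̄_x = Λ(𝒪(Θ))` (★ `IsLambdaOfAt`) and a symplectic lift `Λ` of `P_T.level` at `x` whose
tower read through `r` is `m.r` — the three conjuncts of ★ `IsAdmissibleAt` read at `x`, token for token as in P-3's (ADM) — IN NORMAL FORM
`m.γ = 1`, `m.Ψ = Π_Z`.  Proof: `x ≫ ψ ≫ ι_c ≫ pr = s_q` (★ `AlgPoints.baseChangeEquiv_symm_apply_left`), so `P_T` at `x` and the (U3∃) triple at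
`𝟙` are two pull-backs of `𝓜.univ` over one moduli point (★ `baseChange_isBaseChangeVia`); ★ RD-T3 `exists_admPackage_along_isBaseChangeVia₂`
moves the package, §1 normalises the marking.
[cite: Milne2005ShimuraVarieties, §6 Thm. 6.11 pp. 74–75 and (63) p. 116] [cite: MumfordFogartyKirwan1994, Ch. 7 §2 Def. 7.2 (p. 129); App. 7A pp. 234–235]
[cite: LangeBirkenhake1992, §8.1 Prop. 8.1.1] -/
theorem exists_admPackage_normalForm_of_junction {N : ℕ} (hδ : IsPolarizationType δ) (𝓜 : SiegelFineModuliScheme g N δ)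
    {Sc : SchemeOver ℂ} (ιc : Sc ⟶ (Motives.baseChange ℚ ℂ).obj 𝓜.M) {T : SchemeOver ℂ} (ψ : T ⟶ Sc)
    (x : ComplexPoints T) {q : ComplexPoints Sc} (hq : AlgPoints.map ψ x = q)
    {r : gspFinAdelic δ} (hr : r ∈ principalLevelSubgroup δ 1)
    {Z : Matrix (Fin g) (Fin g) ℂ} (hZ : Z ∈ siegelUpperHalfSpace g)
    (hex : ∃ (P' : PolarizedAbelianSchemeWithLevel g N δ (specOver ℚ ℂ).left)
        (G : P'.A.X.left ⟶ 𝓜.univ.A.X.left) (Ĝ : P'.D.hat.X.left ⟶ 𝓜.univ.D.hat.X.left),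
        P'.IsBaseChangeVia 𝓜.univ ((AlgPoints.baseChangeEquiv (algebraMap ℚ ℂ) 𝓜.M).symm (AlgPoints.map ιc q)).left G Ĝ ∧
        IsAdmissibleAt hδ r Z hZ P') :
    letI P := 𝓜.univ.baseChange (ψ.left ≫ ιc.left ≫ pullback.fst 𝓜.M.hom (Spec.map (CommRingCat.ofHom (algebraMap ℚ ℂ))))
    ∃ (m : SiegelAdelicMarking ⟨jOfSiegel δ Z, SiegelComplexRecordSystem.jOfSiegel_mem_C0pm hδ.1 hZ⟩ r
          (P.A.fibre x.left).toAbelianVariety)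
      (Θ : CartierDivisor (P.A.fibre x.left).toAbelianVariety.X.left) (Λ : P.level.SymplecticLift x.left Θ δ),
      Θ.IsAmple ∧ P.A.IsLambdaOfAt x.left P.D P.pol.lam Θ ∧
      (∀ ⦃M : ℕ⦄, N ∣ M → M ≠ 0 → ∀ (y : Fin g ⊕ Fin g → ZMod M) (v : Fin g ⊕ Fin g → ℚ),
        AdelicCongr ((r⁻¹ : gspFinAdelic δ) : GL (Fin g ⊕ Fin g) finAdeleQ) 1 v (fun i => ((y i).val : ℚ) / M) →
          ((Λ.lift M (Multiplicative.ofAdd y)) : (P.A.fibre x.left).toAbelianVariety.Points ℂ) = m.r v) ∧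
      m.γ = 1 ∧ (∀ v : Fin g ⊕ Fin g → ℝ, m.Ψ v = siegelPeriodMap δ Z v) := by
  subst hq
  obtain ⟨P', G, Ĝ, hP', m₁, Θ₁, Λ₁, hample₁, hlam₁, htower₁⟩ := hex
  -- the point equation `x ≫ (ψ ≫ ι_c ≫ pr) = 𝟙 ≫ s_q`: two pull-backs of `𝓜.univ` over ONE moduli point
  have hp : x.left ≫ (ψ.left ≫ ιc.left ≫ pullback.fst 𝓜.M.hom (Spec.map (CommRingCat.ofHom (algebraMap ℚ ℂ)))) =
      𝟙 (Spec (CommRingCat.of ℂ)) ≫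
        ((AlgPoints.baseChangeEquiv (algebraMap ℚ ℂ) 𝓜.M).symm (AlgPoints.map ιc (AlgPoints.map ψ x))).left := by
    rw [Category.id_comp, AlgPoints.baseChangeEquiv_symm_apply_left]
    rfl
  obtain ⟨e₁, e₂, -, -, m₂, Θ₂, Λ₂, hample₂, hlam₂, htower₂, -, -, -⟩ :=
    SiegelAdelicMarking.exists_admPackage_along_isBaseChangeVia₂ hP'
      (𝓜.univ.baseChange_isBaseChangeVia
        (ψ.left ≫ ιc.left ≫ pullback.fst 𝓜.M.hom (Spec.map (CommRingCat.ofHom (algebraMap ℚ ℂ)))))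
      hp hδ (hZ := hZ) m₁ Θ₁ Λ₁ hample₁ hlam₁ htower₁
  -- normal form of the transported marking (the tower clause only sees `m.r`)
  obtain ⟨m, hγ, hΨ, hr⟩ := m₂.exists_normalForm_of_mem_one hδ.1 hZ hr
  refine ⟨m, Θ₂, Λ₂, hample₂, hlam₂, fun M hNM hM y v hv => (htower₂ hNM hM y v hv).trans (hr v).symm, hγ,
    fun v => ?_⟩
  rw [hΨ, siegelPeriodEquiv_apply]

end Literature.AlgebraicGeometry.ModuliOfAbelianVarieties

end
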